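import Literature.NumberTheory.Automorphic.Liu2021.AlbaneseBaseChangeComplexSplit
import Literature.AlgebraicGeometry.Motives.AlbaneseDimensionBaseChange
import Literature.AlgebraicGeometry.Motives.AbelianVarietyBiproductIsogenies
import Literature.AlgebraicGeometry.Motives.AmpleDivisorBiproduct
import Literature.AlgebraicGeometry.Motives.AbelianVarietyProjectiveChart
import Literature.AlgebraicGeometry.Motives.JacobianThetaDivisor
import HarnessLib

/-!
# Liu 2021, §2.1 / Lemma 2.4 — the complex-Jacobian biproduct model of `Alb_X ⊗_k ℂ`

Layer `Literature/NumberTheory/Automorphic/Liu2021`, namespace `Literature.NumberTheory.Automorphic.Liu2021.AppendixC`.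
KERNEL ONLY: theorems; no definition, no named fact, no instance, no `sorry` (net debt 0).

For a smooth projective `X / k` (`k ⊆ ℂ`, characteristic `0`) with an Albanese datum `a = (Alb_X, α)` (Liu, Def. 2.3),
★ `Albanese.exists_isGalois_split_baseChange_complex_compat` (G4ℂ) presents `Alb_X ⊗_k ℂ` as the biproduct of the
complexified Jacobians `J(E_c) ⊗_L ℂ` of the geometric pieces `E_c` of `X ⊗_k L` (`L/k` finite Galois).  Here the
factors are replaced by the GENUINELY COMPLEX Jacobians `J'_c = J(E_c ⊗_L ℂ)` (★
`nonempty_jacobian_of_isSmoothProjective_of_algebra_complex`), which are only ISOGENOUS to `J(E_c) ⊗_L ℂ` in the tree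
(★ `Jacobian.exists_isIsogeny_baseChange_complex`, Grothendieck FGA VI Thm. 3.3 (iii) / Serre 1958–59 no. 2 Thm. 2):
the model is the biproduct `Y = ⨁_c J'_c` with its legs `πY_c`, `ιY_c`, the comparison ISOGENY
`v = ⨁_c u_c : Y → Alb_X ⊗_k ℂ` (★ `IsIsogeny.biproduct_map`, Mumford §19), the maps of the complex pieces
`eY_c : E_c ⊗_L ℂ → X ⊗_k ℂ`, `lY_c : (E_c ⊗ ℂ)² → ∇X ⊗_k ℂ`, and the two laws `lY_c ≫ incl_ℂ = eY_c × eY_c`,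
`lY_c ≫ α_ℂ = [x − y]'_c ≫ ιY_c ≫ v` (Liu §2.1 Prop. l. 1190–1200, Lemma 2.4 (1) l. 1220–1228).

* `Albanese.exists_complexJacobian_biproduct` — the model, for `X` of any relative dimension `d`.
* `Albanese.exists_complexJacobian_biproduct_theta` — for a CURVE `X` and under Riemann's theorem (the named fact
  ★ `Jacobian.riemann_brillNoetherLocus_isPrincipalPolarizationDivisor`, taken as a hypothesis): the model together with
  theta data `W_c` on the pieces (a Riemann theta divisor defining the canonical principal polarisation whenever
  `dim J'_c ≥ 1`; Lange Lemma 4.2.1 (iii), Milne JV Thm. 6.6), an AMPLE divisor `Θ'` on `Y` (the box product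
  `⊠_c W_c`, ★ `AbelianVariety.exists_isAmple_weilPairingLevel_eq_prod_of_biproduct`) and the product formula
  `ē_N^{Θ'}(P, Q) = ∏_c ē_N^{W_c}(πY_c P, πY_c Q)` (Mumford §20 (3)).

Use (cell `hodgecm-mathlib`, d6 `stub_RosH` work order, frame `GSComplexModel`): the fields `C … lY_α` of the model.

## References
* [Liu2021] Y. Liu, *Fourier–Jacobi cycles and arithmetic relative trace formula*, Camb. J. Math. 9 (2021) (arXiv:1208.5697v3,
  FJcycle.tex), §2.1 Proposition l. 1190–1200, Def. 2.3, Lemma 2.4 (1) l. 1220–1228.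
* [Grothendieck1962FGA6] A. Grothendieck, FGA VI (Sém. Bourbaki 232), Thm. 3.3 (iii).
* [MumfordAV1970] D. Mumford, *Abelian Varieties* (1970), §19 Remark p. 172.
-/

open CategoryTheory CategoryTheory.Limits AlgebraicGeometry MonoidalCategory CartesianMonoidalCategory
open Literature.AlgebraicGeometry.Motives
open AbelianVariety (bcSpec bcFunctor)

noncomputable section

namespace Literature.NumberTheory.Automorphic.Liu2021.AppendixC

/-- An isomorphism of abelian varieties is an isogeny (surjective and finite on schemes). [folklore] -/
private theorem cjm_isIsogeny_of_iso {K : Type} [Field K] {A B : AbelianVariety K} (φ : A ≅ B) :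
    AbelianVariety.IsIsogeny φ.hom := by
  haveI : IsIso (AbelianVariety.Hom.toSchemeHom φ.hom) :=
    ⟨AbelianVariety.Hom.toSchemeHom φ.inv, by
      constructor
      · change AbelianVariety.Hom.toSchemeHom (φ.hom ≫ φ.inv) = _; rw [φ.hom_inv_id]; rfl
      · change AbelianVariety.Hom.toSchemeHom (φ.inv ≫ φ.hom) = _; rw [φ.inv_hom_id]; rfl⟩
  exact ⟨inferInstance, inferInstance⟩

/-- The scheme morphism under a composite of homomorphisms is the composite. [folklore] -/
private theorem cjm_comp_hom₃ {K : Type} [Field K] {A B C : AbelianVariety K} (f : A ⟶ B) (g : B ⟶ C) :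
    (f ≫ g).hom.hom.hom = f.hom.hom.hom ≫ g.hom.hom.hom := rfl

/-- **The complex-Jacobian biproduct model of `Alb_X ⊗_k ℂ`** (Liu §2.1 / Lemma 2.4 (1), with FGA VI 3.3 (iii)): for a smooth
projective `X / k`, `k ⊆ ℂ` of characteristic `0`, of relative dimension `d`, with Albanese datum `a`, there are finitely
many smooth projective geometrically irreducible complex `d`-folds `E'_c` (the complexified geometric pieces of `X`) with
complex Jacobians `J'_c`, a complex abelian variety `Y` presented as the BIPRODUCT of the `J'_c` by `πY_c`, `ιY_c`, an
ISOGENY `v : Y → Alb_X ⊗_k ℂ`, maps `eY_c : E'_c → X ⊗_k ℂ`, `lY_c : E'_c ⊗ E'_c → ∇X ⊗_k ℂ` with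
`lY_c ≫ incl_ℂ = (eY_c ⊗ eY_c) ≫ μ` and `lY_c ≫ α_ℂ = [x − y]'_c ≫ (ιY_c ≫ v)`.
[cite: Liu2021, §2.1 Proposition (FJcycle.tex l. 1190–1192) with proof (l. 1194–1200) and Lemma 2.4 (1) (proof, l. 1220–1228)]
[cite: Grothendieck1962FGA6, Thm. 3.3 (iii)] [cite: MumfordAV1970, §19 Remark p. 172] -/
theorem Albanese.exists_complexJacobian_biproduct {k : Type} [Field k] [CharZero k] [Algebra k ℂ]
    {d : ℕ} (X : SchemeOver k) [SmoothOfRelativeDimension d X.hom] (hX : IsProjectiveOver X) (a : Albanese X) :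
    ∃ (C : Type) (_ : Fintype C) (E' : C → SchemeOver ℂ) (_ : ∀ c, IsSmoothProjective d (E' c))
      (J' : ∀ c, Jacobian (E' c)) (Y : AbelianVariety ℂ) (πY : ∀ c, Y ⟶ (J' c).J) (ιY : ∀ c, (J' c).J ⟶ Y)
      (_ : ∀ c, ιY c ≫ πY c = 𝟙 _) (_ : ∀ c c', c ≠ c' → ιY c ≫ πY c' = 0) (_ : ∑ c, πY c ≫ ιY c = 𝟙 Y)
      (v : Y ⟶ a.Alb.baseChange ℂ) (_ : AbelianVariety.IsIsogeny v)
      (eY : ∀ c, E' c ⟶ (bcFunctor k ℂ).obj X) (lY : ∀ c, E' c ⊗ E' c ⟶ (bcFunctor k ℂ).obj a.nabla.N),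
      (∀ c, lY c ≫ (bcFunctor k ℂ).map a.nabla.incl = (eY c ⊗ₘ eY c) ≫ Functor.LaxMonoidal.μ (bcFunctor k ℂ) X X) ∧
      (∀ c, lY c ≫ (bcFunctor k ℂ).map a.α = (J' c).diff ≫ (ιY c ≫ v).hom.hom.hom) := by
  classical
  -- the ABSTRACT-`eX` form of G4ℂ (kernel device: the tower identification `eX` stays opaque throughout)
  obtain ⟨L, _, _, _, _, _, hτ, eX, -, -, C, _, E, e, hE, -, P, 𝒥, π, i, l, h1, h2, h3, hincl, hα⟩ :=
    Albanese.exists_isGalois_split_baseChange_complex_compat_abstract (d := d) X hX a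
  -- the complex pieces and their complex Jacobians
  have hE' : ∀ c, IsSmoothProjective d ((bcFunctor L ℂ).obj (E c)) := fun c => (hE c).baseChange_obj ℂ
  have J' : ∀ c, Jacobian ((bcFunctor L ℂ).obj (E c)) := fun c =>
    Classical.choice (nonempty_jacobian_of_isSmoothProjective_of_algebra_complex (hE' c))
  -- the comparison isogenies `u_c : J'_c → J(E_c) ⊗_L ℂ` (FGA VI 3.3 (iii))
  have hu : ∀ c, ∃ u : (J' c).J ⟶ (𝒥 c).J.baseChange ℂ,
      (J' c).diff ≫ u.hom.hom.hom =
          (Functor.Monoidal.μIso (bcFunctor L ℂ) (E c) (E c)).hom ≫ (bcFunctor L ℂ).map (𝒥 c).diff ∧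
        AbelianVariety.IsIsogeny u := fun c =>
    Jacobian.exists_isIsogeny_baseChange_complex (hE c) (P c) (𝒥 c) (J' c)
  choose u hud hui using hu
  -- finite biproducts of complex abelian varieties (Mumford §19), as LOCAL instances
  haveI : HasTerminal (AbelianVariety ℂ) :=
    haveI : ∀ B : AbelianVariety ℂ, Unique (B ⟶ AbelianVariety.trivial ℂ) := fun B =>
      haveI : Unique (B.toGrp ⟶ (AbelianVariety.trivial ℂ).toGrp) := Grp.uniqueHomToTrivial B.toGrp
      InducedCategory.homEquiv.unique
    hasTerminal_of_unique (AbelianVariety.trivial ℂ)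
  haveI : HasFiniteProducts (AbelianVariety ℂ) := hasFiniteProducts_of_has_binary_and_terminal
  haveI : HasFiniteBiproducts (AbelianVariety ℂ) := HasFiniteBiproducts.of_hasFiniteProducts
  -- the identification `⨁_c J(E_c) ⊗ ℂ ≅ Alb_X ⊗ ℂ` given by the presentation `(π, i)`
  have hww' : (biproduct.desc i : (⨁ fun c => (𝒥 c).J.baseChange ℂ) ⟶ _) ≫ biproduct.lift π = 𝟙 _ := by
    refine biproduct.hom_ext _ _ fun c' => biproduct.hom_ext' _ _ fun c => ?_
    simp only [Category.assoc, biproduct.lift_π, biproduct.ι_desc_assoc, Category.id_comp]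
    by_cases hcc : c = c'
    · subst hcc; rw [h1, biproduct.ι_π_self]
    · rw [h2 c c' hcc, biproduct.ι_π_ne _ hcc]
  have hw'w : biproduct.lift π ≫ (biproduct.desc i : (⨁ fun c => (𝒥 c).J.baseChange ℂ) ⟶ _) = 𝟙 _ := by
    rw [biproduct.lift_desc, h3]
  -- the comparison isogeny `v = ⨁ u_c ≫ w`
  have hv : AbelianVariety.IsIsogeny
      (biproduct.desc fun c => u c ≫ i c : (⨁ fun c => (J' c).J) ⟶ a.Alb.baseChange ℂ) := by
    rw [← biproduct.map_desc]
    exact AbelianVariety.isIsogeny_comp (AbelianVariety.IsIsogeny.biproduct_map hui)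
      (cjm_isIsogeny_of_iso ⟨biproduct.desc i, biproduct.lift π, hww', hw'w⟩)
  refine ⟨C, inferInstance, fun c => (bcFunctor L ℂ).obj (E c), hE', J', ⨁ fun c => (J' c).J,
    fun c => biproduct.π (fun c => (J' c).J) c, fun c => biproduct.ι (fun c => (J' c).J) c,
    fun c => biproduct.ι_π_self _ c, fun c c' h => biproduct.ι_π_ne _ h, biproduct.total,
    biproduct.desc fun c => u c ≫ i c, hv,
    fun c => (bcFunctor L ℂ).map (e c) ≫ eX.hom, l, hincl, fun c => ?_⟩
  -- the `α`-law
  rw [hα c, biproduct.ι_desc, cjm_comp_hom₃, ← Category.assoc ((J' c).diff), hud c, Functor.Monoidal.μIso_hom]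
  erw [Category.assoc]
  rfl

/-- **The complex-Jacobian biproduct model of `Alb_X ⊗_k ℂ` WITH THETA DATA, for a curve `X / k` (`k ⊆ ℂ`), under
Riemann's theorem** (the named fact ★ `Jacobian.riemann_brillNoetherLocus_isPrincipalPolarizationDivisor` as the hypothesis
`hFR`): the model of `Albanese.exists_complexJacobian_biproduct` together with divisors `W_c` on the complex Jacobians
`J'_c` of the pieces — a Riemann theta divisor defining the canonical PRINCIPAL polarisation whenever `dim J'_c ≥ 1`
(Lange, Lemma 4.2.1 (iii) with Prop. 4.1.2; Milne, *Jacobian Varieties*, Thm. 6.6), an ample divisor in genus `0` —, an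
AMPLE Cartier divisor `Θ'` on `Y` (a presentation of the box product `∑_c πY_c^* W_c`; EGA II 4.6.13 (iv)) and the
PAIRING-LEVEL product formula `ē_N^{Θ'}(P, Q) = ∏_c ē_N^{W_c}(πY_c P, πY_c Q)` (Mumford §20 (3); the `[N]`-dominance of the
factors is taken as the explicit binder `hN`). [cite: Liu2021, §2.1 Proposition (FJcycle.tex l. 1190–1192) and Lemma 2.4 (1) (proof, l. 1220–1228)]
[cite: Lange2023AbelianVarietiesComplex, §4.2.1 Lemma 4.2.1 (iii) with §4.1.2 Prop. 4.1.2] [cite: MumfordAV1970, §20 (property (3) of e_n, p. 186)]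
[cite: EGAII, Prop. 4.6.13 (iv)] -/
theorem Albanese.exists_complexJacobian_biproduct_theta
    (hFR : Jacobian.riemann_brillNoetherLocus_isPrincipalPolarizationDivisor)
    {k : Type} [Field k] [CharZero k] [Algebra k ℂ] (X : SchemeOver k) [SmoothOfRelativeDimension 1 X.hom]
    (hX : IsProjectiveOver X) (a : Albanese X) :
    ∃ (C : Type) (_ : Fintype C) (E' : C → SchemeOver ℂ) (_ : ∀ c, IsSmoothProjective 1 (E' c))
      (J' : ∀ c, Jacobian (E' c)) (Y : AbelianVariety ℂ) (πY : ∀ c, Y ⟶ (J' c).J) (ιY : ∀ c, (J' c).J ⟶ Y)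
      (_ : ∀ c, ιY c ≫ πY c = 𝟙 _) (_ : ∀ c c', c ≠ c' → ιY c ≫ πY c' = 0) (_ : ∑ c, πY c ≫ ιY c = 𝟙 Y)
      (v : Y ⟶ a.Alb.baseChange ℂ) (_ : AbelianVariety.IsIsogeny v)
      (eY : ∀ c, E' c ⟶ (bcFunctor k ℂ).obj X) (lY : ∀ c, E' c ⊗ E' c ⟶ (bcFunctor k ℂ).obj a.nabla.N)
      (_ : ∀ c, lY c ≫ (bcFunctor k ℂ).map a.nabla.incl = (eY c ⊗ₘ eY c) ≫ Functor.LaxMonoidal.μ (bcFunctor k ℂ) X X)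
      (_ : ∀ c, lY c ≫ (bcFunctor k ℂ).map a.α = (J' c).diff ≫ (ιY c ≫ v).hom.hom.hom)
      (W : ∀ c, CartierDivisor (J' c).J.X.left)
      (_ : ∀ c, 1 ≤ (J' c).J.dim →
        (J' c).IsRiemannThetaDivisor (W c) ∧ (J' c).J.IsPrincipalPolarizationDivisor (W c))
      (Θ' : CartierDivisor Y.X.left), Θ'.IsAmple ∧
      ∀ (N : ℕ) [IsDominant (AbelianVariety.Hom.toSchemeHom ((N : ℤ) • 𝟙 Y))]
        (hN : ∀ c, IsDominant (AbelianVariety.Hom.toSchemeHom ((N : ℤ) • 𝟙 (J' c).J))) (P Q : Y.torsionPoints ℂ N),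
        Y.weilPairingLevel Θ' P Q =
          ∏ c, (haveI := hN c;
            (J' c).J.weilPairingLevel (W c)
              ⟨AlgPoints.map (πY c).hom.hom.hom P.1, AbelianVariety.map_mem_torsionPoints (πY c) P.2⟩
              ⟨AlgPoints.map (πY c).hom.hom.hom Q.1, AbelianVariety.map_mem_torsionPoints (πY c) Q.2⟩) := by
  classical
  obtain ⟨C, _, E', hE', J', Y, πY, ιY, h1, h2, h3, v, hv, eY, lY, hincl, hα⟩ :=
    Albanese.exists_complexJacobian_biproduct (d := 1) X hX a
  -- theta data on the pieces: Riemann's divisor in genus `≥ 1`, any ample divisor in genus `0`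
  have hWex : ∀ c, ∃ W : CartierDivisor (J' c).J.X.left,
      (1 ≤ (J' c).J.dim → (J' c).IsRiemannThetaDivisor W ∧ (J' c).J.IsPrincipalPolarizationDivisor W) ∧
        W.IsAmple := by
    intro c
    by_cases h : 1 ≤ (J' c).J.dim
    · obtain ⟨W, hR, hP⟩ := hFR (E' c) (hE' c) (J' c) h
      exact ⟨W, fun _ => ⟨hR, hP⟩, hP.1⟩
    · obtain ⟨W, hW⟩ := ChartFamily.exists_isAmple_of_chart (J' c).J
      exact ⟨W, fun h' => absurd h' h, hW⟩
  choose W hW hWa using hWex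
  rcases isEmpty_or_nonempty C with hC | hC
  · -- no pieces: `𝟙 Y = ∑_∅ = 0`, every point of `Y` is the identity, any ample divisor will do
    obtain ⟨Θ', hΘ'⟩ := ChartFamily.exists_isAmple_of_chart Y
    have hY : (𝟙 Y : Y ⟶ Y) = 0 := by rw [← h3]; exact Fintype.sum_empty _
    refine ⟨C, inferInstance, E', hE', J', Y, πY, ιY, h1, h2, h3, v, hv, eY, lY, hincl, hα, W, hW, Θ', hΘ',
      fun N _ hN P Q => ?_⟩
    have hQ : Q = 1 := by
      apply Subtype.ext
      change Q.1 = (1 : Y.Points ℂ)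
      have hid : AlgPoints.map (𝟙 Y : Y ⟶ Y).hom.hom.hom Q.1 = Q.1 := by unfold AlgPoints.map; simp
      rw [← hid, hY]
      unfold AlgPoints.map
      rw [AbelianVariety.hom_zero]
      simp
    rw [Fintype.prod_empty, hQ, AbelianVariety.weilPairingLevel_one_right]
  · obtain ⟨Θ', hΘ', hlaw⟩ := AbelianVariety.exists_isAmple_weilPairingLevel_eq_prod_of_biproduct
      (fun c => (J' c).J) Y πY ιY h1 h2 h3 W hWa
    exact ⟨C, inferInstance, E', hE', J', Y, πY, ιY, h1, h2, h3, v, hv, eY, lY, hincl, hα, W, hW, Θ', hΘ',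
      fun N _ hN P Q => hlaw N P Q⟩

end Literature.NumberTheory.Automorphic.Liu2021.AppendixC

end

/-! ## §2 (edition 2) — the complex pieces as a COLIMIT COFAN of `X ⊗_k ℂ`, and their irreducibility

The model of §1 with two more exports APPENDED LAST (cell `hodgecm-mathlib`, d6 `stub_RosH` glue, the piece-map input
(P-i) of the frame `GSComplexModel`): the maps `eY_c : E'_c → X ⊗_k ℂ` of the complex pieces form a colimit cofan in
`SchemeOver ℂ` — `X ⊗_k ℂ = ∐_c E'_c`: finite coproducts of schemes are universal, i.e. stable under base change
(Mathlib `FinitaryExtensive Scheme`), applied to the `L`-level cofan `X ⊗_k L = ∐_c E_c` of ★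
`Albanese.exists_isGalois_split_baseChange_complex_compat_abstract` along `Spec ℂ → Spec L` and transported along
the tower identification `eX : (X ⊗_k L) ⊗_L ℂ ≅ X ⊗_k ℂ` — and every piece `E'_c` is an irreducible space
(geometrically irreducible over the point `Spec ℂ`).  Consumed through ★
`Morphisms.Over.exists_pieceMap_of_isColimit_cofan_of_irreducibleSpace` (Hecke translates between two levels of a tower
of curves map complex pieces into complex pieces).

* `nonempty_isColimit_cofan_bcFunctor` — base change of a finite colimit cofan of `L`-schemes is a colimit cofan.
* `Albanese.exists_complexJacobian_biproduct_cofan`, `Albanese.exists_complexJacobian_biproduct_theta_cofan` — the two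
  heads of §1 with `Nonempty (IsColimit (Cofan.mk (X ⊗_k ℂ) eY))` and `∀ c, IrreducibleSpace (E'_c)` appended.
-/

noncomputable section

namespace Literature.NumberTheory.Automorphic.Liu2021.AppendixC

/-- **Base change of a finite coproduct decomposition of `L`-schemes.**  If `(e_c : E_c ⟶ S)_c` is a finite colimit
cofan in `SchemeOver L`, then `(e_c ⊗_L L' : E_c ⊗_L L' ⟶ S ⊗_L L')_c` is a colimit cofan in `SchemeOver L'`: finite
coproducts of schemes are universal — stable under pullback (Mathlib `FinitaryExtensive Scheme`,
`FinitaryPreExtensive.isUniversal_finiteCoproducts`) —, the base-change squares `E_c ⊗_L L' → E_c` over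
`S ⊗_L L' → S` are cartesian (★ `Limits.isPullback_pullback_map_left`), and `Over.forget` creates the coproduct
(★ `Morphisms.isColimit_cofan_left`). [cite: GortzWedhorn2020, (4.5) Prop. 4.16 (p. 101) and (4.7) (pp. 107–108) with (3.5) Example 3.11 (p. 73)] -/
theorem nonempty_isColimit_cofan_bcFunctor {L L' : Type} [Field L] [Field L'] [Algebra L L'] {C : Type} [Finite C]
    {E : C → SchemeOver L} {S : SchemeOver L} (e : ∀ c, E c ⟶ S) (hc : IsColimit (Cofan.mk S e)) :
    Nonempty (IsColimit (Cofan.mk ((bcFunctor L L').obj S) fun c => (bcFunctor L L').map (e c))) := by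
  -- the underlying cofan of schemes is a colimit, hence a universal one
  obtain ⟨hcS⟩ := Literature.AlgebraicGeometry.Morphisms.isColimit_cofan_left hc
  have hau : IsUniversalColimit (Cofan.mk S.left fun c => (e c).left) :=
    FinitaryPreExtensive.isUniversal_finiteCoproducts hcS
  -- pull it back along `Spec L' → Spec L`: the base-change squares are cartesian
  have hS' : Nonempty (IsColimit
      (Cofan.mk ((bcFunctor L L').obj S).left fun c => ((bcFunctor L L').map (e c)).left)) := by
    refine hau (Cofan.mk ((bcFunctor L L').obj S).left fun c => ((bcFunctor L L').map (e c)).left)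
      (Discrete.natTrans fun c => pullback.fst (E c.as).hom (bcSpec L L')) (pullback.fst S.hom (bcSpec L L')) ?_
      (NatTrans.Equifibered.of_discrete _) fun c => ?_
    · ext ⟨c⟩
      simp only [NatTrans.comp_app, Discrete.natTrans_app, Cofan.mk_ι_app, Functor.const_map_app]
      exact (Literature.AlgebraicGeometry.Limits.pullback_map_left_comp_fst (bcSpec L L') (e c)).symm
    · exact Literature.AlgebraicGeometry.Limits.isPullback_pullback_map_left (bcSpec L L') (e c.as)
  obtain ⟨hS'⟩ := hS'
  -- … and lift back to `SchemeOver L'` (`Over.forget` creates colimits)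
  exact ⟨isColimitOfReflects (Over.forget _)
    ((Cofan.isColimitMapCoconeEquiv (Over.forget _) _ (Cofan.mk _ fun c => (bcFunctor L L').map (e c))).symm hS')⟩

/-- **The complex-Jacobian biproduct model of `Alb_X ⊗_k ℂ`, WITH THE COFAN OF THE PIECES** (edition 2 of
`Albanese.exists_complexJacobian_biproduct`, same construction): for a smooth projective `X / k`, `k ⊆ ℂ` of
characteristic `0`, of relative dimension `d`, with Albanese datum `a`, there are finitely many smooth projective
geometrically irreducible complex `d`-folds `E'_c` with complex Jacobians `J'_c`, a complex abelian variety `Y`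
presented as the BIPRODUCT of the `J'_c`, an ISOGENY `v : Y → Alb_X ⊗_k ℂ`, maps `eY_c : E'_c → X ⊗_k ℂ`,
`lY_c : E'_c ⊗ E'_c → ∇X ⊗_k ℂ` with the `incl`- and `α`-laws of §1, AND: `(eY_c)_c` is a colimit cofan in
`SchemeOver ℂ` (`X ⊗_k ℂ = ∐_c E'_c`, by `nonempty_isColimit_cofan_bcFunctor` on the `L`-level cofan, transported
along `eX`) and each `E'_c` is an irreducible space.
[cite: Liu2021, §2.1 Proposition (FJcycle.tex l. 1190–1192) with proof (l. 1194–1200) and Lemma 2.4 (1) (proof, l. 1220–1228)]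
[cite: Grothendieck1962FGA6, Thm. 3.3 (iii)] [cite: MumfordAV1970, §19 Remark p. 172]
[cite: GortzWedhorn2020, (4.5) Prop. 4.16 (p. 101) and (4.7) (pp. 107–108) with (3.5) Example 3.11 (p. 73)] -/
theorem Albanese.exists_complexJacobian_biproduct_cofan {k : Type} [Field k] [CharZero k] [Algebra k ℂ]
    {d : ℕ} (X : SchemeOver k) [SmoothOfRelativeDimension d X.hom] (hX : IsProjectiveOver X) (a : Albanese X) :
    ∃ (C : Type) (_ : Fintype C) (E' : C → SchemeOver ℂ) (_ : ∀ c, IsSmoothProjective d (E' c))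
      (J' : ∀ c, Jacobian (E' c)) (Y : AbelianVariety ℂ) (πY : ∀ c, Y ⟶ (J' c).J) (ιY : ∀ c, (J' c).J ⟶ Y)
      (_ : ∀ c, ιY c ≫ πY c = 𝟙 _) (_ : ∀ c c', c ≠ c' → ιY c ≫ πY c' = 0) (_ : ∑ c, πY c ≫ ιY c = 𝟙 Y)
      (v : Y ⟶ a.Alb.baseChange ℂ) (_ : AbelianVariety.IsIsogeny v)
      (eY : ∀ c, E' c ⟶ (bcFunctor k ℂ).obj X) (lY : ∀ c, E' c ⊗ E' c ⟶ (bcFunctor k ℂ).obj a.nabla.N),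
      (∀ c, lY c ≫ (bcFunctor k ℂ).map a.nabla.incl = (eY c ⊗ₘ eY c) ≫ Functor.LaxMonoidal.μ (bcFunctor k ℂ) X X) ∧
      (∀ c, lY c ≫ (bcFunctor k ℂ).map a.α = (J' c).diff ≫ (ιY c ≫ v).hom.hom.hom) ∧
      Nonempty (IsColimit (Cofan.mk ((bcFunctor k ℂ).obj X) eY)) ∧ (∀ c, IrreducibleSpace (E' c).left) := by
  classical
  -- the ABSTRACT-`eX` form of G4ℂ (kernel device: the tower identification `eX` stays opaque throughout)
  obtain ⟨L, _, _, _, _, _, hτ, eX, -, -, C, _, E, e, hE, hcol, P, 𝒥, π, i, l, h1, h2, h3, hincl, hα⟩ :=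
    Albanese.exists_isGalois_split_baseChange_complex_compat_abstract (d := d) X hX a
  -- the complex pieces and their complex Jacobians
  have hE' : ∀ c, IsSmoothProjective d ((bcFunctor L ℂ).obj (E c)) := fun c => (hE c).baseChange_obj ℂ
  have J' : ∀ c, Jacobian ((bcFunctor L ℂ).obj (E c)) := fun c =>
    Classical.choice (nonempty_jacobian_of_isSmoothProjective_of_algebra_complex (hE' c))
  -- the comparison isogenies `u_c : J'_c → J(E_c) ⊗_L ℂ` (FGA VI 3.3 (iii))
  have hu : ∀ c, ∃ u : (J' c).J ⟶ (𝒥 c).J.baseChange ℂ,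
      (J' c).diff ≫ u.hom.hom.hom =
          (Functor.Monoidal.μIso (bcFunctor L ℂ) (E c) (E c)).hom ≫ (bcFunctor L ℂ).map (𝒥 c).diff ∧
        AbelianVariety.IsIsogeny u := fun c =>
    Jacobian.exists_isIsogeny_baseChange_complex (hE c) (P c) (𝒥 c) (J' c)
  choose u hud hui using hu
  -- finite biproducts of complex abelian varieties (Mumford §19), as LOCAL instances
  haveI : HasTerminal (AbelianVariety ℂ) :=
    haveI : ∀ B : AbelianVariety ℂ, Unique (B ⟶ AbelianVariety.trivial ℂ) := fun B =>
      haveI : Unique (B.toGrp ⟶ (AbelianVariety.trivial ℂ).toGrp) := Grp.uniqueHomToTrivial B.toGrp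
      InducedCategory.homEquiv.unique
    hasTerminal_of_unique (AbelianVariety.trivial ℂ)
  haveI : HasFiniteProducts (AbelianVariety ℂ) := hasFiniteProducts_of_has_binary_and_terminal
  haveI : HasFiniteBiproducts (AbelianVariety ℂ) := HasFiniteBiproducts.of_hasFiniteProducts
  -- the identification `⨁_c J(E_c) ⊗ ℂ ≅ Alb_X ⊗ ℂ` given by the presentation `(π, i)`
  have hww' : (biproduct.desc i : (⨁ fun c => (𝒥 c).J.baseChange ℂ) ⟶ _) ≫ biproduct.lift π = 𝟙 _ := by
    refine biproduct.hom_ext _ _ fun c' => biproduct.hom_ext' _ _ fun c => ?_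
    simp only [Category.assoc, biproduct.lift_π, biproduct.ι_desc_assoc, Category.id_comp]
    by_cases hcc : c = c'
    · subst hcc; rw [h1, biproduct.ι_π_self]
    · rw [h2 c c' hcc, biproduct.ι_π_ne _ hcc]
  have hw'w : biproduct.lift π ≫ (biproduct.desc i : (⨁ fun c => (𝒥 c).J.baseChange ℂ) ⟶ _) = 𝟙 _ := by
    rw [biproduct.lift_desc, h3]
  -- the comparison isogeny `v = ⨁ u_c ≫ w`
  have hv : AbelianVariety.IsIsogeny
      (biproduct.desc fun c => u c ≫ i c : (⨁ fun c => (J' c).J) ⟶ a.Alb.baseChange ℂ) := by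
    rw [← biproduct.map_desc]
    exact AbelianVariety.isIsogeny_comp (AbelianVariety.IsIsogeny.biproduct_map hui)
      (cjm_isIsogeny_of_iso ⟨biproduct.desc i, biproduct.lift π, hww', hw'w⟩)
  -- (edition 2) the complex cofan: base change of the `L`-cofan, transported along `eX`
  have hcofan : Nonempty (IsColimit (Cofan.mk ((bcFunctor k ℂ).obj X) fun c => (bcFunctor L ℂ).map (e c) ≫ eX.hom)) := by
    obtain ⟨hcol⟩ := hcol
    obtain ⟨hℂ⟩ := nonempty_isColimit_cofan_bcFunctor (L' := ℂ) e hcol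
    exact ⟨IsColimit.ofIsoColimit hℂ (Cofan.ext eX fun c => rfl)⟩
  -- (edition 2) the complex pieces are irreducible spaces (geometrically irreducible over the point `Spec ℂ`)
  have hirr : ∀ c, IrreducibleSpace ((bcFunctor L ℂ).obj (E c)).left := fun c => by
    haveI := (hE' c).geometricallyIrreducible
    exact GeometricallyIrreducible.irreducibleSpace_of_subsingleton ((bcFunctor L ℂ).obj (E c)).hom
  refine ⟨C, inferInstance, fun c => (bcFunctor L ℂ).obj (E c), hE', J', ⨁ fun c => (J' c).J,
    fun c => biproduct.π (fun c => (J' c).J) c, fun c => biproduct.ι (fun c => (J' c).J) c,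
    fun c => biproduct.ι_π_self _ c, fun c c' h => biproduct.ι_π_ne _ h, biproduct.total,
    biproduct.desc fun c => u c ≫ i c, hv,
    fun c => (bcFunctor L ℂ).map (e c) ≫ eX.hom, l, hincl, fun c => ?_, hcofan, hirr⟩
  -- the `α`-law
  rw [hα c, biproduct.ι_desc, cjm_comp_hom₃, ← Category.assoc ((J' c).diff), hud c, Functor.Monoidal.μIso_hom]
  erw [Category.assoc]
  rfl

/-- **The complex-Jacobian biproduct model WITH THETA DATA AND THE COFAN OF THE PIECES, for a curve `X / k`, under
Riemann's theorem** (edition 2 of `Albanese.exists_complexJacobian_biproduct_theta`, same construction over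
`Albanese.exists_complexJacobian_biproduct_cofan`): the model, the theta data `W_c` on the pieces (Riemann theta
divisor and principal polarisation whenever `dim J'_c ≥ 1`), an AMPLE `Θ'` on `Y` with the PAIRING-LEVEL product
formula, AND — appended last — the colimit cofan `X ⊗_k ℂ = ∐_c E'_c` and the irreducibility of the pieces.
[cite: Liu2021, §2.1 Proposition (FJcycle.tex l. 1190–1192) and Lemma 2.4 (1) (proof, l. 1220–1228)]
[cite: Lange2023AbelianVarietiesComplex, §4.2.1 Lemma 4.2.1 (iii) with §4.1.2 Prop. 4.1.2] [cite: MumfordAV1970, §20 (property (3) of e_n, p. 186)]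
[cite: EGAII, Prop. 4.6.13 (iv)] [cite: GortzWedhorn2020, (4.5) Prop. 4.16 (p. 101) and (4.7) (pp. 107–108) with (3.5) Example 3.11 (p. 73)] -/
theorem Albanese.exists_complexJacobian_biproduct_theta_cofan
    (hFR : Jacobian.riemann_brillNoetherLocus_isPrincipalPolarizationDivisor)
    {k : Type} [Field k] [CharZero k] [Algebra k ℂ] (X : SchemeOver k) [SmoothOfRelativeDimension 1 X.hom]
    (hX : IsProjectiveOver X) (a : Albanese X) :
    ∃ (C : Type) (_ : Fintype C) (E' : C → SchemeOver ℂ) (_ : ∀ c, IsSmoothProjective 1 (E' c))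
      (J' : ∀ c, Jacobian (E' c)) (Y : AbelianVariety ℂ) (πY : ∀ c, Y ⟶ (J' c).J) (ιY : ∀ c, (J' c).J ⟶ Y)
      (_ : ∀ c, ιY c ≫ πY c = 𝟙 _) (_ : ∀ c c', c ≠ c' → ιY c ≫ πY c' = 0) (_ : ∑ c, πY c ≫ ιY c = 𝟙 Y)
      (v : Y ⟶ a.Alb.baseChange ℂ) (_ : AbelianVariety.IsIsogeny v)
      (eY : ∀ c, E' c ⟶ (bcFunctor k ℂ).obj X) (lY : ∀ c, E' c ⊗ E' c ⟶ (bcFunctor k ℂ).obj a.nabla.N)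
      (_ : ∀ c, lY c ≫ (bcFunctor k ℂ).map a.nabla.incl = (eY c ⊗ₘ eY c) ≫ Functor.LaxMonoidal.μ (bcFunctor k ℂ) X X)
      (_ : ∀ c, lY c ≫ (bcFunctor k ℂ).map a.α = (J' c).diff ≫ (ιY c ≫ v).hom.hom.hom)
      (W : ∀ c, CartierDivisor (J' c).J.X.left)
      (_ : ∀ c, 1 ≤ (J' c).J.dim →
        (J' c).IsRiemannThetaDivisor (W c) ∧ (J' c).J.IsPrincipalPolarizationDivisor (W c))
      (Θ' : CartierDivisor Y.X.left), Θ'.IsAmple ∧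
      (∀ (N : ℕ) [IsDominant (AbelianVariety.Hom.toSchemeHom ((N : ℤ) • 𝟙 Y))]
        (hN : ∀ c, IsDominant (AbelianVariety.Hom.toSchemeHom ((N : ℤ) • 𝟙 (J' c).J))) (P Q : Y.torsionPoints ℂ N),
        Y.weilPairingLevel Θ' P Q =
          ∏ c, (haveI := hN c;
            (J' c).J.weilPairingLevel (W c)
              ⟨AlgPoints.map (πY c).hom.hom.hom P.1, AbelianVariety.map_mem_torsionPoints (πY c) P.2⟩
              ⟨AlgPoints.map (πY c).hom.hom.hom Q.1, AbelianVariety.map_mem_torsionPoints (πY c) Q.2⟩)) ∧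
      Nonempty (IsColimit (Cofan.mk ((bcFunctor k ℂ).obj X) eY)) ∧ (∀ c, IrreducibleSpace (E' c).left) := by
  classical
  obtain ⟨C, _, E', hE', J', Y, πY, ιY, h1, h2, h3, v, hv, eY, lY, hincl, hα, hcofan, hirr⟩ :=
    Albanese.exists_complexJacobian_biproduct_cofan (d := 1) X hX a
  -- theta data on the pieces: Riemann's divisor in genus `≥ 1`, any ample divisor in genus `0`
  have hWex : ∀ c, ∃ W : CartierDivisor (J' c).J.X.left,
      (1 ≤ (J' c).J.dim → (J' c).IsRiemannThetaDivisor W ∧ (J' c).J.IsPrincipalPolarizationDivisor W) ∧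
        W.IsAmple := by
    intro c
    by_cases h : 1 ≤ (J' c).J.dim
    · obtain ⟨W, hR, hP⟩ := hFR (E' c) (hE' c) (J' c) h
      exact ⟨W, fun _ => ⟨hR, hP⟩, hP.1⟩
    · obtain ⟨W, hW⟩ := ChartFamily.exists_isAmple_of_chart (J' c).J
      exact ⟨W, fun h' => absurd h' h, hW⟩
  choose W hW hWa using hWex
  rcases isEmpty_or_nonempty C with hC | hC
  · -- no pieces: `𝟙 Y = ∑_∅ = 0`, every point of `Y` is the identity, any ample divisor will do
    obtain ⟨Θ', hΘ'⟩ := ChartFamily.exists_isAmple_of_chart Y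
    have hY : (𝟙 Y : Y ⟶ Y) = 0 := by rw [← h3]; exact Fintype.sum_empty _
    refine ⟨C, inferInstance, E', hE', J', Y, πY, ιY, h1, h2, h3, v, hv, eY, lY, hincl, hα, W, hW, Θ', hΘ',
      fun N _ hN P Q => ?_, hcofan, hirr⟩
    have hQ : Q = 1 := by
      apply Subtype.ext
      change Q.1 = (1 : Y.Points ℂ)
      have hid : AlgPoints.map (𝟙 Y : Y ⟶ Y).hom.hom.hom Q.1 = Q.1 := by unfold AlgPoints.map; simp
      rw [← hid, hY]
      unfold AlgPoints.map
      rw [AbelianVariety.hom_zero]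
      simp
    rw [Fintype.prod_empty, hQ, AbelianVariety.weilPairingLevel_one_right]
  · obtain ⟨Θ', hΘ', hlaw⟩ := AbelianVariety.exists_isAmple_weilPairingLevel_eq_prod_of_biproduct
      (fun c => (J' c).J) Y πY ιY h1 h2 h3 W hWa
    exact ⟨C, inferInstance, E', hE', J', Y, πY, ιY, h1, h2, h3, v, hv, eY, lY, hincl, hα, W, hW, Θ', hΘ',
      fun N _ hN P Q => hlaw N P Q, hcofan, hirr⟩

end Literature.NumberTheory.Automorphic.Liu2021.AppendixC

end
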